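import Summits.CriticalPhenomena.SAWScalingLimit.Theses.SAWDevelopingMap
import Summits.CriticalPhenomena.SAWScalingLimit.Theorems.ObservableToSLE.Negative.Identification
import Summits.CriticalPhenomena.SAWScalingLimit.Theorems.SAWDevelopingMapObservableToSLETargetTransport
import Summits.CriticalPhenomena.SAWScalingLimit.Theorems.SAWDevelopingMapObservableToSLEShortChordLocalityHelpers
import Summits.CriticalPhenomena.SAWScalingLimit.Theorems.SAWDevelopingMapObservableToSLEChordalCarrier
import Summits.CriticalPhenomena.SAWScalingLimit.Theorems.SAWDevelopingMapObservableToSLERestrictionIdentifies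
import Summits.CriticalPhenomena.SAWScalingLimit.Theorems.SAWDevelopingMapObservableToSLECanonicalTransferReductionHA
import Summits.CriticalPhenomena.SAWScalingLimit.Theorems.SAWDevelopingMapObservableToSLEHullApproxLimit
import Summits.CriticalPhenomena.SAWScalingLimit.Theorems.SAWDevelopingMapObservableToSLEHullApproxDomain
import Summits.CriticalPhenomena.SAWScalingLimit.Theorems.SAWDevelopingMapObservableToSLERestrictionCocycle
import Literature.Probability.RandomPlanarGeometry.RestrictionHullsProofs
import Literature.Probability.RandomPlanarGeometry.RestrictionHullsRiemannProofs
import Literature.Probability.RandomPlanarGeometry.JordanDomainProofs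
import HarnessLib

/-!
# Crux `SAWDevelopingMap.ObservableToSLE` (stmt-CriticalPhenomena-10472), line
`floor-ratio-restriction-bootstrap`: THE FLOOR PART, ASSEMBLED

Landing target:
`Summits/CriticalPhenomena/SAWScalingLimit/Theorems/SAWDevelopingMapObservableToSLEFloorPart.lean`
(`--supports stmt-CriticalPhenomena-10472`; lead prover-line-stmt-CriticalPhenomena-10472-c1-0).

With stubs 1, 3, 4 (= 4a + 4b through the reduction `canonicalTransfer_of_hullApprox`) and 6 of the line
LANDED, the whole floor-class identification is a kernel-checked consequence of the crux hypothesis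
`HexObservableLimit` and of exactly TWO lattice estimates, both implied by DCS Conjecture 1 and neither in
print: half-plane arch tightness (HPAT, registered stub `stub_halfPlaneArchTightness`) and the uniform
injectivity modulus (UIM, registered stub `stub_uniformModulus`).  This file records, sorry-free and over
tree vocabulary only:

* `hullApprox` -- the continuum hull approximation (HA), from the landed 4a/4b;
* `stub_floorIdentification_of_estimates` (registered sub-goal) -- HPAT, UIM, HexObservableLimit give:
  every probability subsequential limit of the critical hexagonal SAW in a FLOOR domain (Jordan, above the
  line through its marked points, flat radius-rho half-discs there) with floor-vertex endpoints is the
  chordal SLE(8/3) law;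
* `stub_floorObservableToSLE_of_estimates` (registered sub-goal) -- HPAT, UIM, HexObservableLimit,
  HexTight give convergence in law to SLE(8/3) on the floor class (the crux NARROWED to the class its
  hypothesis speaks about, via the landed soft half `Negative.convergesInLawToSLE_of_identification`);
* `stub_observableToSLE_of_estimates` (registered sub-goal) -- HPAT, UIM, DomainExtension give the crux
  BY NAME: what remains of the crux beyond the two estimates is exactly the boundary-class / endpoint
  extension W2 (`stub_domainExtension`), for which no mechanism is known (the hypothesis is silent off
  flat-pinned marked points: `Negative.flat_premise_false_on_unitDisc`, OrientationSilence).
-/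

noncomputable section

open scoped BigOperators Topology NNReal ENNReal Classical
open Filter Set MeasureTheory Metric
open Literature.Probability.LatticeModels (HexVertex hexGraph hexCenter)
open Literature.Probability.RandomPlanarGeometry
open Literature.Probability.RandomPlanarGeometry.SAW
open UpperHalfPlane (upperHalfPlaneSet)

namespace Summit.CriticalPhenomena.SAWScalingLimit.Theorems.ObservableToSLE.FloorRatio

open Summit.CriticalPhenomena.SAWScalingLimit.Theses.SAWDevelopingMap (HexObservableLimit HexTight ObservableToSLE)

/-- **(HA) hull approximation from outside**, assembled from its landed analytic half
`stub_hullApproxLimit` (p98031) and topological half `stub_hullApproxDomain` (p112182): every hull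
subdomain `D'` of a Dobrushin domain is approximated by Jordan hull subdomains `D'' ⊇ D'` swallowing a metric
collar of `D'` with `Φ'_{A''}(0)^{5/8} ≤ (1+ε) Φ'_A(0)^{5/8}`.
[cite: LawlerSchrammWerner2003Restriction, Lemma 3.5 and its proof (p. 12)] -/
theorem hullApprox :
    ∀ (D D' : DobrushinDomain), D.IsHullSubdomain D' →
      ∀ (φ : ConformalEquiv upperHalfPlaneSet D.carrier)
      (Φ : ConformalEquiv (upperHalfPlaneSet \ φ.pullbackHull D') upperHalfPlaneSet) (d : ℝ),
      D.IsChordalUniformizing φ → IsRestrictionMap (φ.pullbackHull D') Φ →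
      HasRestrictionDeriv (φ.pullbackHull D') Φ d →
      ∀ ε : ℝ, 0 < ε → ∃ (D'' : DobrushinDomain)
        (Φ'' : ConformalEquiv (upperHalfPlaneSet \ φ.pullbackHull D'') upperHalfPlaneSet) (d'' η : ℝ),
        D.IsHullSubdomain D'' ∧ D'.carrier ⊆ D''.carrier ∧ 0 < η ∧
        (∀ z ∈ D.carrier, Metric.infDist z D'.carrier ≤ η → z ∈ D''.carrier) ∧
        IsRestrictionMap (φ.pullbackHull D'') Φ'' ∧ HasRestrictionDeriv (φ.pullbackHull D'') Φ'' d'' ∧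
        d'' ^ ((5 : ℝ) / 8) ≤ (1 + ε) * d ^ ((5 : ℝ) / 8) := by
  intro D D' hD' φ Φ d hφ hΦ hd ε hε
  obtain ⟨B, r, hB, hBA, hr, hfar, hbound⟩ := stub_hullApproxLimit D D' φ Φ d hD' hφ hΦ hd ε hε
  obtain ⟨D'', η, hD'', hsub, hη, hcollar, hBD''⟩ :=
    stub_hullApproxDomain D D' φ B r hD' hφ hB hBA hr hfar
  have hA'' : IsStarHull (φ.pullbackHull D'') :=
    IsStarHull.pullbackHull JordanDomain.isSimplyConnected_holds hφ hD''
  obtain ⟨Φ'', hΦ'', -⟩ := IsStarHull.existsUnique_isRestrictionMap_holds hA''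
  obtain ⟨d'', -, -, hd''⟩ := IsStarHull.exists_hasRestrictionDeriv_holds hA'' hΦ''
  exact ⟨D'', Φ'', d'', η, hD'', hsub, hη, hcollar, hΦ'', hd'',
    hbound D'' Φ'' d'' hD'' hBD'' hΦ'' hd''⟩

/-- **The floor part of the crux, assembled (registered sub-goal `stub_floorIdentification_of_estimates`).**
Half-plane arch tightness → uniform injectivity modulus → `HexObservableLimit` → identification of every
probability subsequential limit of the critical hexagonal SAW on the floor class as chordal SLE(8/3).
Composition of the landed stubs: `stub_shortChordLocality_reduction` (p74295), `stub_restrictionCocycle`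
(p90257), `canonicalTransfer_of_hullApprox` (p94044) with `hullApprox`, `stub_chordalCarrier_ofModulus`
(p77021), `stub_restrictionIdentifies` (p85931).
[cite: LawlerSchrammWerner2003Restriction, Thm. 6.1 (p. 23), transposed; DCS 2012 Conj. 2 as hypothesis] -/
theorem stub_floorIdentification_of_estimates :
    (∀ ε : ℝ, 0 < ε → ∃ K : ℝ, 0 < K ∧ ∀ (n : ℕ), 1 ≤ n → ∀ (Λ B : Finset HexVertex)
      (s t : Sym2 HexVertex), s ∈ hexDomainBoundary Λ → t ∈ hexDomainBoundary Λ → s ≠ t →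
      dist (hexMidpoint s) (hexMidpoint t) ≤ n → (hexMidpoint t).im = (hexMidpoint s).im →
      (∀ v ∈ Λ, (hexMidpoint s).im < (hexCenter v).im) →
      (∀ v : HexVertex, v ∈ B ↔ ((hexMidpoint s).im < (hexCenter v).im ∧
        dist (hexCenter v) (hexMidpoint s) ≤ 2 * K * n)) →
      (∑ γ : HexMidEdgeSAW Λ s t, if ∃ v ∈ γ.verts, K * n ≤ dist (hexCenter v) (hexMidpoint s)
        then hexCriticalFugacity ^ γ.length else 0) ≤
      ε * ∑ γ : HexMidEdgeSAW B s t, hexCriticalFugacity ^ γ.length) →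
    (∀ (D : DobrushinDomain) (ρ : ℝ) (a b : ℝ → HexVertex),
      (0 < ρ ∧ (D.pt 1).im = (D.pt 0).im ∧ D.carrier ⊆ {z : ℂ | (D.pt 0).im < z.im} ∧
      D.carrier ∩ ball (D.pt 0) ρ = {z : ℂ | (D.pt 0).im < z.im} ∩ ball (D.pt 0) ρ ∧
      D.carrier ∩ ball (D.pt 1) ρ = {z : ℂ | (D.pt 1).im < z.im} ∩ ball (D.pt 1) ρ) →
      (IsEmbEndpointApprox hexGraph hexCenter D a b ∧ ∀ᶠ δ : ℝ in 𝓝[>] 0,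
      (∃ u : HexVertex, hexGraph.Adj (a δ) u ∧ ((δ : ℂ) * hexCenter u).im ≤ (D.pt 0).im) ∧
      (∃ u : HexVertex, hexGraph.Adj (b δ) u ∧ ((δ : ℂ) * hexCenter u).im ≤ (D.pt 1).im)) →
      ∀ ε η : ℝ, 0 < ε → 0 < η → ∃ θ : ℝ, 0 < θ ∧ ∀ᶠ δ : ℝ in 𝓝[>] 0,
        hexSAWLaw D.carrier δ (a δ) (b δ) {γ | γ.curve ∉ CurveClass.modulusClass ε θ} ≤
          ENNReal.ofReal η) →
    HexObservableLimit →
    ∀ (D : DobrushinDomain) (ρ : ℝ) (a b : ℝ → HexVertex),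
    (0 < ρ ∧ (D.pt 1).im = (D.pt 0).im ∧ D.carrier ⊆ {z : ℂ | (D.pt 0).im < z.im} ∧
    D.carrier ∩ ball (D.pt 0) ρ = {z : ℂ | (D.pt 0).im < z.im} ∩ ball (D.pt 0) ρ ∧
    D.carrier ∩ ball (D.pt 1) ρ = {z : ℂ | (D.pt 1).im < z.im} ∩ ball (D.pt 1) ρ) → (IsEmbEndpointApprox hexGraph hexCenter D a b ∧ ∀ᶠ δ : ℝ in 𝓝[>] 0,
    (∃ u : HexVertex, hexGraph.Adj (a δ) u ∧ ((δ : ℂ) * hexCenter u).im ≤ (D.pt 0).im) ∧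
    (∃ u : HexVertex, hexGraph.Adj (b δ) u ∧ ((δ : ℂ) * hexCenter u).im ≤ (D.pt 1).im)) →
    ∀ μ : Measure (CurveClass ℂ), IsProbabilityMeasure μ →
    IsSubseqLimitLaw (fun δ (γ : HexDomainSAW D.carrier δ (a δ) (b δ)) => γ.curve)
    (fun δ => hexSAWLaw D.carrier δ (a δ) (b δ)) μ →
    IsSLELaw ((8 : ℝ≥0) / 3) D μ := by
  intro hHPAT hUIM hO D ρ a b hD hab μ hμ hsub
  have hSCL := stub_shortChordLocality_reduction hHPAT
  have hARL := stub_restrictionCocycle hO hSCL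
  have hR := canonicalTransfer_of_hullApprox hullApprox hARL
  exact stub_restrictionIdentifies D a b μ hab.1 hμ hsub
    (stub_chordalCarrier_ofModulus hUIM hR D ρ a b hD hab μ hμ hsub)
    (fun D' φ Φ d hD' hφ hΦ hd => hR D D' ρ φ Φ d a b hD hD' hφ hΦ hd hab)

/-- **The crux narrowed to the floor class, modulo the two estimates (registered sub-goal
`stub_floorObservableToSLE_of_estimates`).**  Half-plane arch tightness → uniform injectivity modulus →
`HexObservableLimit` → `HexTight` → for every FLOOR Dobrushin domain (Jordan, above the horizontal line
through its two marked points, flat radius-`ρ` half-discs at both) and every floor-vertex endpoint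
approximation, the critical hexagonal SAW law `hexSAWLaw`, pushed to `CurveClass ℂ`, converges in law to
chordal SLE(8/3) (`ConvergesInLawToSLE`, exactly the conclusion of the crux on this class; soft half =
`Negative.convergesInLawToSLE_of_identification`, p69742).
[cite: DuminilCopinSmirnov2012, Conjecture 1 (arXiv:1007.0575 p. 7), restricted to the floor class] -/
theorem stub_floorObservableToSLE_of_estimates :
    (∀ ε : ℝ, 0 < ε → ∃ K : ℝ, 0 < K ∧ ∀ (n : ℕ), 1 ≤ n → ∀ (Λ B : Finset HexVertex)
      (s t : Sym2 HexVertex), s ∈ hexDomainBoundary Λ → t ∈ hexDomainBoundary Λ → s ≠ t →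
      dist (hexMidpoint s) (hexMidpoint t) ≤ n → (hexMidpoint t).im = (hexMidpoint s).im →
      (∀ v ∈ Λ, (hexMidpoint s).im < (hexCenter v).im) →
      (∀ v : HexVertex, v ∈ B ↔ ((hexMidpoint s).im < (hexCenter v).im ∧
        dist (hexCenter v) (hexMidpoint s) ≤ 2 * K * n)) →
      (∑ γ : HexMidEdgeSAW Λ s t, if ∃ v ∈ γ.verts, K * n ≤ dist (hexCenter v) (hexMidpoint s)
        then hexCriticalFugacity ^ γ.length else 0) ≤
      ε * ∑ γ : HexMidEdgeSAW B s t, hexCriticalFugacity ^ γ.length) →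
    (∀ (D : DobrushinDomain) (ρ : ℝ) (a b : ℝ → HexVertex),
      (0 < ρ ∧ (D.pt 1).im = (D.pt 0).im ∧ D.carrier ⊆ {z : ℂ | (D.pt 0).im < z.im} ∧
      D.carrier ∩ ball (D.pt 0) ρ = {z : ℂ | (D.pt 0).im < z.im} ∩ ball (D.pt 0) ρ ∧
      D.carrier ∩ ball (D.pt 1) ρ = {z : ℂ | (D.pt 1).im < z.im} ∩ ball (D.pt 1) ρ) →
      (IsEmbEndpointApprox hexGraph hexCenter D a b ∧ ∀ᶠ δ : ℝ in 𝓝[>] 0,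
      (∃ u : HexVertex, hexGraph.Adj (a δ) u ∧ ((δ : ℂ) * hexCenter u).im ≤ (D.pt 0).im) ∧
      (∃ u : HexVertex, hexGraph.Adj (b δ) u ∧ ((δ : ℂ) * hexCenter u).im ≤ (D.pt 1).im)) →
      ∀ ε η : ℝ, 0 < ε → 0 < η → ∃ θ : ℝ, 0 < θ ∧ ∀ᶠ δ : ℝ in 𝓝[>] 0,
        hexSAWLaw D.carrier δ (a δ) (b δ) {γ | γ.curve ∉ CurveClass.modulusClass ε θ} ≤
          ENNReal.ofReal η) →
    HexObservableLimit → HexTight →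
    ∀ (D : DobrushinDomain) (ρ : ℝ) (a b : ℝ → HexVertex),
    (0 < ρ ∧ (D.pt 1).im = (D.pt 0).im ∧ D.carrier ⊆ {z : ℂ | (D.pt 0).im < z.im} ∧
    D.carrier ∩ ball (D.pt 0) ρ = {z : ℂ | (D.pt 0).im < z.im} ∩ ball (D.pt 0) ρ ∧
    D.carrier ∩ ball (D.pt 1) ρ = {z : ℂ | (D.pt 1).im < z.im} ∩ ball (D.pt 1) ρ) →
    (IsEmbEndpointApprox hexGraph hexCenter D a b ∧ ∀ᶠ δ : ℝ in 𝓝[>] 0,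
    (∃ u : HexVertex, hexGraph.Adj (a δ) u ∧ ((δ : ℂ) * hexCenter u).im ≤ (D.pt 0).im) ∧
    (∃ u : HexVertex, hexGraph.Adj (b δ) u ∧ ((δ : ℂ) * hexCenter u).im ≤ (D.pt 1).im)) →
    ConvergesInLawToSLE ((8 : ℝ≥0) / 3) D
      (fun δ (γ : HexDomainSAW D.carrier δ (a δ) (b δ)) => γ.curve)
      (fun δ => hexSAWLaw D.carrier δ (a δ) (b δ)) := by
  intro hHPAT hUIM hO hT D ρ a b hD hab
  exact Summit.CriticalPhenomena.SAWScalingLimit.Theorems.ObservableToSLE.Negative.convergesInLawToSLE_of_identification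
    hab.1 (hT D a b hab.1)
    (fun μ hμ hsub => stub_floorIdentification_of_estimates hHPAT hUIM hO D ρ a b hD hab μ hμ hsub)

/-- **What the crux hinges on (registered sub-goal `stub_observableToSLE_of_estimates`).**  Half-plane arch
tightness → uniform injectivity modulus → the boundary-class / endpoint extension W2 (verbatim the registered
stub `stub_domainExtension`) → the crux `ObservableToSLE` BY NAME (through the landed
`Negative.observableToSLE_iff_identification`, p69742).  The three antecedents are exactly the three
remaining `sorry`s of the line's skeleton. [cite: DuminilCopinSmirnov2012, Conjecture 1 (arXiv:1007.0575 p. 7)] -/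
theorem stub_observableToSLE_of_estimates :
    (∀ ε : ℝ, 0 < ε → ∃ K : ℝ, 0 < K ∧ ∀ (n : ℕ), 1 ≤ n → ∀ (Λ B : Finset HexVertex)
      (s t : Sym2 HexVertex), s ∈ hexDomainBoundary Λ → t ∈ hexDomainBoundary Λ → s ≠ t →
      dist (hexMidpoint s) (hexMidpoint t) ≤ n → (hexMidpoint t).im = (hexMidpoint s).im →
      (∀ v ∈ Λ, (hexMidpoint s).im < (hexCenter v).im) →
      (∀ v : HexVertex, v ∈ B ↔ ((hexMidpoint s).im < (hexCenter v).im ∧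
        dist (hexCenter v) (hexMidpoint s) ≤ 2 * K * n)) →
      (∑ γ : HexMidEdgeSAW Λ s t, if ∃ v ∈ γ.verts, K * n ≤ dist (hexCenter v) (hexMidpoint s)
        then hexCriticalFugacity ^ γ.length else 0) ≤
      ε * ∑ γ : HexMidEdgeSAW B s t, hexCriticalFugacity ^ γ.length) →
    (∀ (D : DobrushinDomain) (ρ : ℝ) (a b : ℝ → HexVertex),
      (0 < ρ ∧ (D.pt 1).im = (D.pt 0).im ∧ D.carrier ⊆ {z : ℂ | (D.pt 0).im < z.im} ∧
      D.carrier ∩ ball (D.pt 0) ρ = {z : ℂ | (D.pt 0).im < z.im} ∩ ball (D.pt 0) ρ ∧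
      D.carrier ∩ ball (D.pt 1) ρ = {z : ℂ | (D.pt 1).im < z.im} ∩ ball (D.pt 1) ρ) →
      (IsEmbEndpointApprox hexGraph hexCenter D a b ∧ ∀ᶠ δ : ℝ in 𝓝[>] 0,
      (∃ u : HexVertex, hexGraph.Adj (a δ) u ∧ ((δ : ℂ) * hexCenter u).im ≤ (D.pt 0).im) ∧
      (∃ u : HexVertex, hexGraph.Adj (b δ) u ∧ ((δ : ℂ) * hexCenter u).im ≤ (D.pt 1).im)) →
      ∀ ε η : ℝ, 0 < ε → 0 < η → ∃ θ : ℝ, 0 < θ ∧ ∀ᶠ δ : ℝ in 𝓝[>] 0,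
        hexSAWLaw D.carrier δ (a δ) (b δ) {γ | γ.curve ∉ CurveClass.modulusClass ε θ} ≤
          ENNReal.ofReal η) →
    (HexObservableLimit → HexTight →
    (
    ∀ (D : DobrushinDomain) (ρ : ℝ) (a b : ℝ → HexVertex),
    (0 < ρ ∧ (D.pt 1).im = (D.pt 0).im ∧ D.carrier ⊆ {z : ℂ | (D.pt 0).im < z.im} ∧
    D.carrier ∩ ball (D.pt 0) ρ = {z : ℂ | (D.pt 0).im < z.im} ∩ ball (D.pt 0) ρ ∧
    D.carrier ∩ ball (D.pt 1) ρ = {z : ℂ | (D.pt 1).im < z.im} ∩ ball (D.pt 1) ρ) → (IsEmbEndpointApprox hexGraph hexCenter D a b ∧ ∀ᶠ δ : ℝ in 𝓝[>] 0,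
    (∃ u : HexVertex, hexGraph.Adj (a δ) u ∧ ((δ : ℂ) * hexCenter u).im ≤ (D.pt 0).im) ∧
    (∃ u : HexVertex, hexGraph.Adj (b δ) u ∧ ((δ : ℂ) * hexCenter u).im ≤ (D.pt 1).im)) →
    ∀ μ : Measure (CurveClass ℂ), IsProbabilityMeasure μ →
    IsSubseqLimitLaw (fun δ (γ : HexDomainSAW D.carrier δ (a δ) (b δ)) => γ.curve)
    (fun δ => hexSAWLaw D.carrier δ (a δ) (b δ)) μ →
    IsSLELaw ((8 : ℝ≥0) / 3) D μ) →
  ∀ (D : DobrushinDomain) (a b : ℝ → HexVertex),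
  IsEmbEndpointApprox hexGraph hexCenter D a b →
  ∀ μ : Measure (CurveClass ℂ), IsProbabilityMeasure μ →
  IsSubseqLimitLaw (fun δ (γ : HexDomainSAW D.carrier δ (a δ) (b δ)) => γ.curve)
  (fun δ => hexSAWLaw D.carrier δ (a δ) (b δ)) μ →
  IsSLELaw ((8 : ℝ≥0) / 3) D μ) →
    ObservableToSLE := by
  intro hHPAT hUIM hExt
  refine Summit.CriticalPhenomena.SAWScalingLimit.Theorems.ObservableToSLE.Negative.observableToSLE_iff_identification.mpr ?_
  intro hO hT
  exact hExt hO hT (stub_floorIdentification_of_estimates hHPAT hUIM hO)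

end Summit.CriticalPhenomena.SAWScalingLimit.Theorems.ObservableToSLE.FloorRatio

end
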